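import Literature.IUT.HodgeArakelov.ModelDef11Output
import Literature.IUT.HodgeArakelov.EtaleThetaDataOfSettingInversion

/-!
# Non-vacuity of the identification binder `hEnv` of `PointedInversionFunctorial.lean` at the GENUINE Prop 1.2 (i) output

Proof-only companion (abc-iut cell, WAVE-4 seat abc-iut-w4-d010 gen 6; cone of [IUTchIII] Cor. 3.12; DAG node
**IUTchII:Prop2.2(i)**, ι-clause). `PointedInversionFunctorial.lean` (p434556/p434825) discharges the `Δ`-stability of
every `α ∈ Aut_top(Π^tp_X̲̲)` from [EtTh] Cor. 2.18 (i) (F-0620, BY NAME) plus ONE identification datum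
`hEnv : ∀ x, Env.recon.projG (Env.isoX x) = 1 ↔ x ∈ (C.rigidData …).aug.ker` («the `Δ` of the Prop 1.2 (i) output
`Env` is `Δ^tp_X ∩ Π^tp_X̲̲ = Ker(aug)`»). HERE: that datum HOLDS — again modulo F-0620 only — at abc-iut-L6-d6's GENUINE
output `ThetaSetting.envOfGroup` (bridge B8 part 6, `ModelDef11Output.lean`) over L2-t8's `C.rigidData` for the Tate
curve `X̲̲_K`, for EVERY choice of the identification `hP` (the output's `isoX` is `hP.some`, an arbitrary topological
automorphism of `Π^tp_X̲̲`; its `projG` is the quotient map by `Ker(aug)`, so `Ker(projG ∘ isoX) = hP.some⁻¹(Ker aug) =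
Ker aug` by the «`G_K` [i.e. `Δ_X`]» clause of Cor. 2.18 (i)). So the `…_of_cor218_i` closers of
`PointedInversionFunctorial.lean` are NOT idle at the genuine data. S. Mochizuki, *Inter-universal Teichmüller theory
II*, kurims (Dec. 2020), Prop. 1.2 (i) p. 25, Prop. 2.2 (i) p. 66 (claim key `Mochizuki2012`, DISPUTED, D-0012);
[EtTh] Cor. 2.18 (i) p. 60. No definitions. Nothing here takes a side on [IUTchIII] Cor. 3.12; typed ≠ proved.
-/

noncomputable section

namespace Literature.IUT.HodgeArakelov

namespace EtaleThetaDataOfSetting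

open Literature.AnabelianGeometry.EtaleTheta Literature.AnabelianGeometry.SemiGraphs
open scoped Literature.AnabelianGeometry.EtaleTheta

variable {p : ℕ} [Fact p.Prime] {D : Literature.AnabelianGeometry.EtaleTheta.ThetaSetting p}
  {E : D.EtaleThetaData} {l : ℕ} (C : E.DoubleUnderline l) {N : ℕ+} (μ : D.CyclotomeMod l N)
  (hC : D.Compat) (hS : D.Sec2Hyps) (h15 : Literature.AnabelianGeometry.EtaleTheta.ThetaSetting.Prop15iii E hC)
  (L : C.CuspLabels) (hl : l.Prime) (hp2 : p ≠ 2) (hpl : p ≠ l) (hζ : ∃ ζ : D.K, IsPrimitiveRoot ζ (4 * l))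
  {η : (C.thetaEnvData μ hC hS).PiYdd → MuN p N} (hη : η ∈ (C.thetaEnvData μ hC hS).thetaCocycles)
  (hZ : Nonempty (ModelCyclotomes.lDeltaQuot (C.rigidData μ hC hS h15 L) ≃* Literature.IUT.HodgeTheaters.ZHat))
  (hP : Nonempty ((Pi C) ≃ₜ* (ThetaSetting.ofDoubleUnderline C μ hC hS hl hp2 hpl hζ hη).PiX))

/-- The «`(Π^tp_X ⊇) G_K` [i.e. `Δ_X`]» clause of [EtTh] Cor. 2.18 (i) at `C.rigidData`, iff form (restated locally so
that this file does not wait for the olean of `PointedInversionFunctorial.lean`; same one-line proof as its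
`mem_augKer_iff_of_cor218_i`). [cite: MochizukiEtTh2009, Cor 2.18(i) p.60] -/
private theorem mem_augKer_iff_of_cor218_i' (R : RigidData.{0} N l) (hR : R = C.rigidData μ hC hS h15 L)
    (h218i : R.Cor218_i) (α : (Pi C) ≃ₜ* (Pi C)) (x : Pi C) :
    x ∈ (C.rigidData μ hC hS h15 L).aug.ker ↔ α x ∈ (C.rigidData μ hC hS h15 L).aug.ker := by
  subst hR
  exact mem_iff_apply_mem_of_map_eq α.toMulEquiv _ (h218i α).2.2.1 x

/-- `Ker(aug)` of L2-t8's `C.rigidData` (the co-restricted augmentation of `Π^tp_X̲̲`) is `{y | D.aug y = 1}` — the two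
phrasings of the identification datum `hEnv` in the tree (this lineage's «`x ∈ (C.rigidData …).aug.ker`» and
abc-iut-w6-d005's «`D.aug (y : D.PiTemp) = 1`», `SubgraphReferenceGenuineIdentification`) AGREE.
[cite: MochizukiEtTh2009, Def 2.13 p.47] -/
theorem mem_augKer_rigidData_iff (y : Pi C) :
    y ∈ (C.rigidData μ hC hS h15 L).aug.ker ↔ D.aug (y : D.PiTemp) = 1 := by
  rw [MonoidHom.mem_ker]
  constructor
  · intro h
    exact congrArg (fun g : ↥D.GK => (g : GQp p)) h
  · intro h
    exact Subtype.ext h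

/-- The `Δ`-stability binder in the `D.aug`-phrasing, for every `α ∈ Aut_top(Π^tp_X̲̲)`, from F-0620.
[cite: MochizukiEtTh2009, Cor 2.18(i) p.60] -/
theorem aug_eq_one_iff_of_cor218_i (R : RigidData.{0} N l) (hR : R = C.rigidData μ hC hS h15 L)
    (h218i : R.Cor218_i) (α : (Pi C) ≃ₜ* (Pi C)) (y : Pi C) :
    D.aug ((α y : Pi C) : D.PiTemp) = 1 ↔ D.aug (y : D.PiTemp) = 1 := by
  rw [← mem_augKer_rigidData_iff C μ hC hS h15 L, ← mem_augKer_rigidData_iff C μ hC hS h15 L,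
    ← mem_augKer_iff_of_cor218_i' C μ hC hS h15 L R hR h218i α y]

/-- **`hEnv` HOLDS at the genuine Prop 1.2 (i) output** `ThetaSetting.envOfGroup` of the Tate curve `X̲̲_K` (abc-iut-L6-d6,
B8 part 6), for every identification `hP`, modulo F-0620: `Env.recon.projG (Env.isoX x) = 1 ↔ x ∈ Ker(aug)`.
[claim: Mochizuki2012, status: disputed] (IUTchII §1 Prop 1.2 (i), kurims p.25) -/
theorem projG_isoX_envOfGroup_eq_one_iff_of_cor218_i (R : RigidData.{0} N l) (hR : R = C.rigidData μ hC hS h15 L)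
    (h218i : R.Cor218_i) (x : Pi C) :
    (ThetaSetting.envOfGroup (C.rigidData μ hC hS h15 L)
          (ThetaSetting.SideData.ofDoubleUnderline C μ hC hS hl hp2 hpl hζ hη) (ThetaSetting.t1Space_Huu C)
          (ThetaSetting.isClosed_ker_aug_thetaEnvData C μ hC hS) hZ (Pi C) hP).recon.projG
        ((ThetaSetting.envOfGroup (C.rigidData μ hC hS h15 L)
          (ThetaSetting.SideData.ofDoubleUnderline C μ hC hS hl hp2 hpl hζ hη) (ThetaSetting.t1Space_Huu C)
          (ThetaSetting.isClosed_ker_aug_thetaEnvData C μ hC hS) hZ (Pi C) hP).isoX x) = 1 ↔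
      x ∈ (C.rigidData μ hC hS h15 L).aug.ker := by
  show (QuotientGroup.mk' (C.rigidData μ hC hS h15 L).aug.ker) (hP.some x) = 1 ↔ _
  rw [QuotientGroup.mk'_apply, QuotientGroup.eq_one_iff]
  exact (mem_augKer_iff_of_cor218_i' C μ hC hS h15 L R hR h218i hP.some x).symm

/-- Hence, at the genuine output, the `Δ`-stability of EVERY topological automorphism `α` of `Π^tp_X̲̲` in the
`Env`-phrasing used by `PointedInversion` («`projG (isoX (α x)) = 1 ↔ projG (isoX x) = 1`») — the binder `hα` of
`PointedInversion.exists_deltaConj_of_aut` — follows from F-0620 alone. [cite: MochizukiEtTh2009, Cor 2.18(i) p.60] -/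
theorem projG_isoX_envOfGroup_stable_of_cor218_i (R : RigidData.{0} N l) (hR : R = C.rigidData μ hC hS h15 L)
    (h218i : R.Cor218_i) (α : (Pi C) ≃ₜ* (Pi C)) (x : Pi C) :
    (ThetaSetting.envOfGroup (C.rigidData μ hC hS h15 L)
          (ThetaSetting.SideData.ofDoubleUnderline C μ hC hS hl hp2 hpl hζ hη) (ThetaSetting.t1Space_Huu C)
          (ThetaSetting.isClosed_ker_aug_thetaEnvData C μ hC hS) hZ (Pi C) hP).recon.projG
        ((ThetaSetting.envOfGroup (C.rigidData μ hC hS h15 L)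
          (ThetaSetting.SideData.ofDoubleUnderline C μ hC hS hl hp2 hpl hζ hη) (ThetaSetting.t1Space_Huu C)
          (ThetaSetting.isClosed_ker_aug_thetaEnvData C μ hC hS) hZ (Pi C) hP).isoX (α x)) = 1 ↔
    (ThetaSetting.envOfGroup (C.rigidData μ hC hS h15 L)
          (ThetaSetting.SideData.ofDoubleUnderline C μ hC hS hl hp2 hpl hζ hη) (ThetaSetting.t1Space_Huu C)
          (ThetaSetting.isClosed_ker_aug_thetaEnvData C μ hC hS) hZ (Pi C) hP).recon.projG
        ((ThetaSetting.envOfGroup (C.rigidData μ hC hS h15 L)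
          (ThetaSetting.SideData.ofDoubleUnderline C μ hC hS hl hp2 hpl hζ hη) (ThetaSetting.t1Space_Huu C)
          (ThetaSetting.isClosed_ker_aug_thetaEnvData C μ hC hS) hZ (Pi C) hP).isoX x) = 1 := by
  rw [projG_isoX_envOfGroup_eq_one_iff_of_cor218_i C μ hC hS h15 L hl hp2 hpl hζ hη hZ hP R hR h218i,
    projG_isoX_envOfGroup_eq_one_iff_of_cor218_i C μ hC hS h15 L hl hp2 hpl hζ hη hZ hP R hR h218i,
    ← mem_augKer_iff_of_cor218_i' C μ hC hS h15 L R hR h218i α x]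

/-- **`hEnv` in abc-iut-w6-d005's phrasing HOLDS at the genuine output**: `Env.recon.projG (Env.isoX y) = 1 ↔ D.aug y = 1`
for `Env :=` L6-d6's `ThetaSetting.envOfGroup` of the Tate curve, every `hP`, modulo F-0620 — the NV witness (T5) asked
for in the «PROP22i-IDENT-GENUINE» plan, with NO re-basing of `isoX` needed (whatever `hP.some` is, it is a topological
automorphism of `Π^tp_X̲̲`, so Cor. 2.18 (i) applies to it). [claim: Mochizuki2012, status: disputed]
(IUTchII §1 Prop 1.2 (i), kurims p.25) -/
theorem projG_isoX_envOfGroup_eq_one_iff_aug_of_cor218_i (R : RigidData.{0} N l)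
    (hR : R = C.rigidData μ hC hS h15 L) (h218i : R.Cor218_i) (y : Pi C) :
    (ThetaSetting.envOfGroup (C.rigidData μ hC hS h15 L)
          (ThetaSetting.SideData.ofDoubleUnderline C μ hC hS hl hp2 hpl hζ hη) (ThetaSetting.t1Space_Huu C)
          (ThetaSetting.isClosed_ker_aug_thetaEnvData C μ hC hS) hZ (Pi C) hP).recon.projG
        ((ThetaSetting.envOfGroup (C.rigidData μ hC hS h15 L)
          (ThetaSetting.SideData.ofDoubleUnderline C μ hC hS hl hp2 hpl hζ hη) (ThetaSetting.t1Space_Huu C)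
          (ThetaSetting.isClosed_ker_aug_thetaEnvData C μ hC hS) hZ (Pi C) hP).isoX y) = 1 ↔
      D.aug (y : D.PiTemp) = 1 := by
  rw [projG_isoX_envOfGroup_eq_one_iff_of_cor218_i C μ hC hS h15 L hl hp2 hpl hζ hη hZ hP R hR h218i,
    mem_augKer_rigidData_iff]

end EtaleThetaDataOfSetting

end Literature.IUT.HodgeArakelov

end
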